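import Summits.ResolutionOfSingularities.ResolutionOfSingularities.Theorems.EquisingularLiftEquisingularLiftNatP1VBCechTransfer
import Summits.ResolutionOfSingularities.ResolutionOfSingularities.Theorems.EquisingularLiftEquisingularLiftNatP1VBProjectiveLine
import Literature.AlgebraicGeometry.Morphisms.CechModuleCoverIndependence
import Literature.AlgebraicGeometry.Morphisms.CechModuleUnit
import Literature.AlgebraicGeometry.Morphisms.CechH1PullbackComp
import Literature.AlgebraicGeometry.Modules.AffineLocalizing
import HarnessLib

/-!
# [OURS · L1 W4.5(b) · LINE (T-j)-PROOF support (G3)] `Ȟ¹(𝒱; 𝒪_Y) = 0` on EVERY affine open cover `𝒱` of a scheme `Y ≅ ℙ¹_{k'}`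
# (`subsingleton_cechMH1_unit_of_iso_PP`)

Cell res-hironaka, LADDER-RESOLUTION rung L, slot W4.5(b), crux chain w45b: EL♮(3) = stmt-ResolutionOfSingularities-20148,
residue (T-j) = F-102 `Literature.AlgebraicGeometry.Resolution.GenusZeroOverCompleteDVR` (LINE (T-j)-PROOF, res-L1-w45b-lead-2 g3,
skeleton `L/res-L1-w45b-lead-2/F102Skeleton.lean`; the `h1` hypothesis of BRICK E in brick B4's use: the closed fibre `C_k ≅ ℙ¹_{k'}`
with the cover `g⁻¹𝒰` induced from an affine cover `𝒰` of `C`). By-signature request «036 → lemma (G3)» of res-L1-w45b-lead-2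
(STATUS 2026-08-27T21:46:48Z; the base is taken as `t := e.hom ≫ toSpec k' 1`, which the request allows); seat res-D-pv-036 g11
(on-call supplier). `--supports stmt-ResolutionOfSingularities-20148 --as helper`. NOT a statement of any manuscript; OURS; AI-written,
weaker than expert review. Definition-free; standard axioms.

THEOREM (`subsingleton_cechMH1_unit_of_iso_PP`). `e : Y ≅ ℙ¹_{k'}` (`ProjCech.PP k' 1`), `𝒱 = (V_i)` ANY family of AFFINE opens
covering `Y`: `Ȟ¹(𝒱; 𝒪_Y) = 0` in the tree's currency `CechMH1 (e.hom ≫ toSpec k' 1) (SheafOfModules.unit Y.ringCatSheaf) V`.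

PROOF. (1) `subsingleton_cechMH1_unit_PP_of_isAffineOpen`: on `ℙ¹_{k'}` itself, `Ȟ¹` of `𝒪` vanishes on the two standard charts
(res-type-027's `P1VB.subsingleton_cechMH1_unit_projectiveLine`, Hartshorne III.5.1) hence on every affine cover (tree
`Morphisms/CechModuleCoverIndependence.subsingleton_cechMH1_iff_of_isAffineOpen`, `IsAffineLocalizing.unit`). (2) transport along `e`:
the opens `e⁻¹.⁻¹ V_i` form an affine cover of `ℙ¹`; a class `x ∈ Ȟ¹(𝒱; 𝒪_Y)` pulls back to `0` along `e.inv` (by (1)), then along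
`e.hom`; but `(e.hom ≫ e.inv)^* = 𝟙^* = id` (tree `Morphisms/CechH1PullbackComp`: `cechComapH1_comp`, `cechComapH1_congr_eq_zero_iff`,
`cechComapH1_id`), so `x = 0`. [cite: Hartshorne1977, III Thm. 4.5, III Thm. 5.1] [folklore]
-/

noncomputable section

open CategoryTheory AlgebraicGeometry TopologicalSpace Opposite
open Literature.AlgebraicGeometry.Morphisms Literature.AlgebraicGeometry.Modules Literature.AlgebraicGeometry

set_option linter.dupNamespace false

namespace Summit.ResolutionOfSingularities.ResolutionOfSingularities.Cruxes.EquisingularLiftNat.F102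

/-- **`Ȟ¹(𝒲; 𝒪) = 0` for every affine open cover `𝒲` of `ℙ¹_{k'}`** (two standard charts + cover independence).
[cite: Hartshorne1977, III Thm. 4.5, III Thm. 5.1] [folklore] -/
theorem subsingleton_cechMH1_unit_PP_of_isAffineOpen {k' : Type} [Field k'] {ι : Type} (W : ι → (ProjCech.PP k' 1).Opens)
    (hW : ∀ i, IsAffineOpen (W i)) (hcov : ⨆ i, W i = ⊤) :
    Subsingleton (CechMH1 (ProjCech.toSpec k' 1) (SheafOfModules.unit (ProjCech.PP k' 1).ringCatSheaf) W) :=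
  (subsingleton_cechMH1_iff_of_isAffineOpen (ProjCech.toSpec k' 1) IsAffineLocalizing.unit
      (fun i : Fin 2 => ProjCech.Dplus k' 1 {i}) W (fun i => P1VB.isAffineOpen_Dplus_singleton k' 1 i) hW
      (P1VB.iSup_Dplus_singleton_eq_top k' 1) hcov).mp
    (P1VB.subsingleton_cechMH1_unit_projectiveLine k')

/-- **(G3) `Ȟ¹(𝒱; 𝒪_Y) = 0` on every affine open cover of a scheme `Y ≅ ℙ¹_{k'}`**, base `t := e.hom ≫ toSpec k' 1`
(transport of the `ℙ¹` statement along the isomorphism: pull back along `e.inv`, then along `e.hom`, and `(e.hom ≫ e.inv)^* = id`).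
This is the `h1` hypothesis of BRICK E `exists_unitSection_eq_of_ker_le_span` for a base change with closed fibre `≅ ℙ¹`.
[cite: Hartshorne1977, III Thm. 4.5, III Thm. 5.1] [folklore] -/
theorem subsingleton_cechMH1_unit_of_iso_PP {k' : Type} [Field k'] {Y : Scheme.{0}} (e : Y ≅ ProjCech.PP k' 1)
    {ι : Type} (V : ι → Y.Opens) (hV : ∀ i, IsAffineOpen (V i)) (hcov : ⨆ i, V i = ⊤) :
    Subsingleton (CechMH1 (e.hom ≫ ProjCech.toSpec k' 1) (SheafOfModules.unit Y.ringCatSheaf) V) := by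
  -- the transported cover of `ℙ¹`
  have hW : ∀ i, IsAffineOpen (preimageFamily e.inv V i) := fun i => (hV i).preimage_of_isIso e.inv
  have hWcov : ⨆ i, preimageFamily e.inv V i = ⊤ := by
    change ⨆ i, e.inv ⁻¹ᵁ V i = ⊤
    rw [← Scheme.Hom.preimage_iSup, hcov]
    rfl
  haveI hP := subsingleton_cechMH1_unit_PP_of_isAffineOpen (preimageFamily e.inv V) hW hWcov
  -- the base structure maps
  have hg : e.inv ≫ (e.hom ≫ ProjCech.toSpec k' 1) = ProjCech.toSpec k' 1 := by
    rw [← Category.assoc, e.inv_hom_id, Category.id_comp]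
  have hh : e.hom ≫ ProjCech.toSpec k' 1 = e.hom ≫ ProjCech.toSpec k' 1 := rfl
  rw [CechMH1_unit] at hP ⊢
  refine ⟨fun x y => ?_⟩
  suffices h0 : ∀ x : CechH1 (e.hom ≫ ProjCech.toSpec k' 1) V, x = 0 by rw [h0 x, h0 y]
  intro x
  -- pull back along `e.inv` (lands in `0`), then along `e.hom`
  have h1 : cechComapH1 (e.hom ≫ ProjCech.toSpec k' 1) (ProjCech.toSpec k' 1) e.inv hg V x = 0 := Subsingleton.elim _ _
  have h2 := congrArg (cechComapH1 (ProjCech.toSpec k' 1) (e.hom ≫ ProjCech.toSpec k' 1) e.hom hh (preimageFamily e.inv V)) h1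
  rw [map_zero, cechComapH1_comp] at h2
  -- `(e.hom ≫ e.inv)^* = 𝟙^* = id`
  have h3 : cechComapH1 (e.hom ≫ ProjCech.toSpec k' 1) (e.hom ≫ ProjCech.toSpec k' 1) (𝟙 Y) (Category.id_comp _) V x = 0 :=
    (cechComapH1_congr_eq_zero_iff (fY := e.hom ≫ ProjCech.toSpec k' 1) V e.hom_inv_id _ (Category.id_comp _) x).mp h2
  have h4 := cechComapH1_id (e.hom ≫ ProjCech.toSpec k' 1) V x
  exact h4.symm.trans h3

/-- **Vanishing of `Ȟ¹` does not depend on the base the Čech groups are indexed by**: for two structure maps `f : X → Spec A`,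
`f' : X → Spec B`, `Ȟ¹(𝒰; M) = 0` over `A` iff over `B` (the cochain groups and differentials are the same; only the scalar action
changes). [folklore] -/
theorem subsingleton_cechMH1_iff_of_base {A B : Type} [CommRing A] [CommRing B] {X : Scheme.{0}} (f : X ⟶ Spec (.of A))
    (f' : X ⟶ Spec (.of B)) (M : X.Modules) {ι : Type} (U : ι → X.Opens) :
    Subsingleton (CechMH1 f M U) ↔ Subsingleton (CechMH1 f' M U) := by
  have key : ∀ {C : Type} [CommRing C] (g : X ⟶ Spec (.of C)),
      Subsingleton (CechMH1 g M U) ↔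
        ∀ c : (i j : ι) → Γ(M, U i ⊓ U j), cechMD1 g M U c = 0 → ∃ b : (i : ι) → Γ(M, U i), cechMD0 g M U b = c := by
    intro C _ g
    constructor
    · intro h c hc
      have h0 := (CechMH1.mk_eq_zero_iff g M U ⟨c, (mem_cechMZ1_iff g M U c).mpr hc⟩).mp (Subsingleton.elim _ _)
      exact (mem_cechMB1_iff g M U c).mp h0
    · intro h
      refine ⟨fun x y => ?_⟩
      obtain ⟨zx, rfl⟩ := CechMH1.mk_surjective g M U x
      obtain ⟨zy, rfl⟩ := CechMH1.mk_surjective g M U y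
      rw [← sub_eq_zero, ← map_sub, CechMH1.mk_eq_zero_iff]
      exact (mem_cechMB1_iff g M U _).mpr (h _ ((mem_cechMZ1_iff g M U _).mp (zx - zy).2))
  rw [key f, key f']
  -- the two conditions are the same statement about the same functions
  exact Iff.rfl

/-- **(G3), any base**: as `subsingleton_cechMH1_unit_of_iso_PP`, with the Čech group indexed by an arbitrary structure map
`t : Y → Spec B`. [cite: Hartshorne1977, III Thm. 4.5, III Thm. 5.1] [folklore] -/
theorem subsingleton_cechMH1_unit_of_iso_PP' {k' : Type} [Field k'] {Y : Scheme.{0}} (e : Y ≅ ProjCech.PP k' 1)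
    {B : Type} [CommRing B] (t : Y ⟶ Spec (.of B))
    {ι : Type} (V : ι → Y.Opens) (hV : ∀ i, IsAffineOpen (V i)) (hcov : ⨆ i, V i = ⊤) :
    Subsingleton (CechMH1 t (SheafOfModules.unit Y.ringCatSheaf) V) :=
  (subsingleton_cechMH1_iff_of_base (e.hom ≫ ProjCech.toSpec k' 1) t _ V).mp
    (subsingleton_cechMH1_unit_of_iso_PP e V hV hcov)

end Summit.ResolutionOfSingularities.ResolutionOfSingularities.Cruxes.EquisingularLiftNat.F102

end
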